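import Literature.Analysis.FluidPDE.SpaceTimeRescaling
import Mathlib.Analysis.Calculus.BumpFunction.InnerProduct
import HarnessLib

/-!
# Local chain rules under space dilations for fields that are `C²` on an open set only

Analysis/FluidPDE glue file (no definitions, no named facts). The covariance lemmas of
`SpaceTimeRescaling.lean` for the Laplacian (`laplacian_stPull`) and Mathlib's
`ContinuousLinearMap.iteratedFDeriv_comp_right` ask for a *globally* `C²` slice. Fields that are
regular only on an open region — the far field `{|x| > R}` of a local Leray solution
(Lemarié-Rieusset 2016, proof of Thm. 15.4, Steps 2–3) — need the local versions, obtained here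
by the standard cutoff device: a function that is `Cⁿ` on an open set agrees near each of its
points with a globally `Cⁿ` function (`ContDiffOn.exists_contDiff_eventuallyEq`, via a smooth
bump `≡ 1` near the point and supported in the set), and the Laplacian / iterated derivatives at
a point only see the germ (`laplacian_congr_nhds`, `Filter.EventuallyEq.iteratedFDeriv`):

* `laplacian_comp_affine_of_contDiffOn` — `Δ (f(x₀ + γ ·))(y) = γ² (Δ f)(x₀ + γ y)` for `f`
  of class `C²` on an open `S ∋ x₀ + γ y`;
* `iteratedFDeriv_two_comp_affine_of_contDiffOn`, `norm_iteratedFDeriv_two_comp_affine_le` —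
  `D²(f(x₀ + γ ·))(y) = D²f(x₀ + γ y) ∘ (γ, γ)` and `‖D²(f(x₀ + γ ·))(y)‖ ≤ γ² ‖D²f(x₀ + γ y)‖`
  under the same hypothesis.

## References

* Folklore (localisation by smooth cutoffs; Hörmander, *The Analysis of Linear Partial
  Differential Operators I*, §1.4).
-/

noncomputable section

open Set Function Filter Metric
open _root_.Topology
open scoped Laplacian

namespace Literature.Analysis.FluidPDE

variable {E : Type*} [NormedAddCommGroup E] [InnerProductSpace ℝ E]
variable {F : Type*} [NormedAddCommGroup F] [NormedSpace ℝ F]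

/-- **A function of class `Cⁿ` on an open set agrees near each point of the set with a globally
`Cⁿ` function** (multiply by a smooth bump `≡ 1` near the point with support in the set).
[folklore] -/
theorem ContDiffOn.exists_contDiff_eventuallyEq {n : ℕ∞} {f : E → F} {S : Set E}
    (hf : ContDiffOn ℝ n f S) (hS : IsOpen S) {x : E} (hx : x ∈ S) :
    ∃ g : E → F, ContDiff ℝ n g ∧ g =ᶠ[𝓝 x] f := by
  obtain ⟨r, hr, hrS⟩ := Metric.isOpen_iff.1 hS x hx
  let χ : ContDiffBump x := ⟨r / 4, r / 2, by positivity, by linarith⟩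
  have hχS : tsupport χ ⊆ S := by
    rw [χ.tsupport_eq]
    exact (closedBall_subset_ball (by show r / 2 < r; linarith)).trans hrS
  refine ⟨fun z => χ z • f z, ?_, ?_⟩
  · rw [contDiff_iff_contDiffAt]
    intro z
    by_cases hz : z ∈ S
    · exact χ.contDiff.contDiffAt.smul (hf.contDiffAt (hS.mem_nhds hz))
    · have hz' : z ∉ tsupport χ := fun h => hz (hχS h)
      have h0 : (fun w => χ w • f w) =ᶠ[𝓝 z] fun _ => 0 := by
        filter_upwards [notMem_tsupport_iff_eventuallyEq.1 hz'] with w hw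
        simp [hw]
      exact contDiffAt_const.congr_of_eventuallyEq h0
  · filter_upwards [closedBall_mem_nhds x (by positivity : 0 < r / 4)] with z hz
    rw [χ.one_of_mem_closedBall hz, one_smul]

/-- Pulling an eventual equality back along the continuous affine map `z ↦ x₀ + γ z`. [folklore] -/
theorem eventuallyEq_comp_affine {β : Type*} {g f : E → β} (x₀ : E) (γ : ℝ) {y : E}
    (h : g =ᶠ[𝓝 (x₀ + γ • y)] f) :
    (fun z => g (x₀ + γ • z)) =ᶠ[𝓝 y] fun z => f (x₀ + γ • z) := by
  have hA : ContinuousAt (fun z : E => x₀ + γ • z) y := by fun_prop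
  exact hA.eventually h

/-- **Local Laplacian chain rule under a space dilation**: if `f` is `C²` on an open set
`S ∋ x₀ + γ y`, then `Δ (f(x₀ + γ ·))(y) = γ² (Δ f)(x₀ + γ y)` (localise to a globally `C²`
function agreeing with `f` near `x₀ + γ y`, then `laplacian_stPull`). [folklore] -/
theorem laplacian_comp_affine_of_contDiffOn [FiniteDimensional ℝ E] {f : E → F} {S : Set E}
    (hf : ContDiffOn ℝ 2 f S)
    (hS : IsOpen S) (x₀ : E) (γ : ℝ) {y : E} (hy : x₀ + γ • y ∈ S) :
    (Δ fun z => f (x₀ + γ • z)) y = γ ^ 2 • (Δ f) (x₀ + γ • y) := by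
  obtain ⟨g, hg, hgf⟩ := ContDiffOn.exists_contDiff_eventuallyEq (n := 2) hf hS hy
  rw [← (InnerProductSpace.laplacian_congr_nhds (eventuallyEq_comp_affine x₀ γ hgf)).eq_of_nhds,
    ← (InnerProductSpace.laplacian_congr_nhds hgf).eq_of_nhds]
  have e : (fun z => g (x₀ + γ • z)) = stPull 0 γ 0 x₀ (fun _ => g) 0 := by
    funext z; simp only [stPull_apply]
  rw [e]
  exact laplacian_stPull 0 γ 0 x₀ (fun _ => g) 0 y hg

/-- **Local chain rule for the second derivative under a space dilation**: if `f` is `C²` on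
an open set `S ∋ x₀ + γ y`, then `D²(f(x₀ + γ ·))(y) = D²f(x₀ + γ y) ∘ (γ ·, γ ·)`. [folklore] -/
theorem iteratedFDeriv_two_comp_affine_of_contDiffOn {f : E → F} {S : Set E}
    (hf : ContDiffOn ℝ 2 f S) (hS : IsOpen S) (x₀ : E) (γ : ℝ) {y : E} (hy : x₀ + γ • y ∈ S) :
    iteratedFDeriv ℝ 2 (fun z => f (x₀ + γ • z)) y =
      (iteratedFDeriv ℝ 2 f (x₀ + γ • y)).compContinuousLinearMap
        fun _ => γ • ContinuousLinearMap.id ℝ E := by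
  obtain ⟨g, hg, hgf⟩ := ContDiffOn.exists_contDiff_eventuallyEq (n := 2) hf hS hy
  rw [← ((eventuallyEq_comp_affine x₀ γ hgf).iteratedFDeriv ℝ 2).eq_of_nhds,
    ← (hgf.iteratedFDeriv ℝ 2).eq_of_nhds]
  -- `z ↦ g (x₀ + γ z) = (w ↦ g (x₀ + w)) ∘ (γ • id)`
  have h1 : (fun z => g (x₀ + γ • z)) =
      (fun w => g (x₀ + w)) ∘ (γ • ContinuousLinearMap.id ℝ E) := by
    funext z; simp
  have hg' : ContDiff ℝ 2 fun w => g (x₀ + w) := hg.comp (contDiff_const.add contDiff_id)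
  rw [h1, ContinuousLinearMap.iteratedFDeriv_comp_right _ hg' y le_rfl]
  simp only [FunLike.coe_smul, Pi.smul_apply, ContinuousLinearMap.coe_id', id_eq]
  rw [iteratedFDeriv_comp_add_left]

/-- **Norm bound for the second derivative under a space dilation**: if `f` is `C²` on an open
set `S ∋ x₀ + γ y`, then `‖D²(f(x₀ + γ ·))(y)‖ ≤ γ² ‖D²f(x₀ + γ y)‖`. [folklore] -/
theorem norm_iteratedFDeriv_two_comp_affine_le {f : E → F} {S : Set E}
    (hf : ContDiffOn ℝ 2 f S) (hS : IsOpen S) (x₀ : E) (γ : ℝ) {y : E} (hy : x₀ + γ • y ∈ S) :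
    ‖iteratedFDeriv ℝ 2 (fun z => f (x₀ + γ • z)) y‖ ≤
      γ ^ 2 * ‖iteratedFDeriv ℝ 2 f (x₀ + γ • y)‖ := by
  rw [iteratedFDeriv_two_comp_affine_of_contDiffOn hf hS x₀ γ hy]
  have hL : ‖γ • ContinuousLinearMap.id ℝ E‖ ≤ |γ| := by
    refine ContinuousLinearMap.opNorm_le_bound _ (abs_nonneg γ) fun z => ?_
    simp [norm_smul]
  calc ‖(iteratedFDeriv ℝ 2 f (x₀ + γ • y)).compContinuousLinearMap
          fun _ => γ • ContinuousLinearMap.id ℝ E‖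
        ≤ ‖iteratedFDeriv ℝ 2 f (x₀ + γ • y)‖ * ∏ _i : Fin 2, ‖γ • ContinuousLinearMap.id ℝ E‖ :=
      ContinuousMultilinearMap.norm_compContinuousLinearMap_le _ _
    _ ≤ ‖iteratedFDeriv ℝ 2 f (x₀ + γ • y)‖ * |γ| ^ 2 := by
      rw [Fin.prod_const]; gcongr
    _ = γ ^ 2 * ‖iteratedFDeriv ℝ 2 f (x₀ + γ • y)‖ := by rw [sq_abs, mul_comm]

end Literature.Analysis.FluidPDE

end
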